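import Mathlib.Analysis.Calculus.MeanValue
import Mathlib.Analysis.SpecialFunctions.Pow.Real
import Mathlib.Analysis.SpecialFunctions.Sqrt
import Literature.Analysis.FunctionSpaces.ContDiffHolderAlgebra
import Literature.Analysis.FunctionSpaces.HolderAlgebra
import HarnessLib

/-!
# Log-convexity of the `C^{k,α}` norms: `‖f‖²_{m+1,α} ≤ 51 ‖f‖_{m,α} ‖f‖_{m+2,α}`

Analysis/FunctionSpaces support file (everything proved). Buckmaster–De Lellis–Székelyhidi–
Vicol 2019, App. A, record as "elementary inequalities" the Hölder interpolation inequalities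
(A.1) `[f]_s ≤ C(ε^{r-s}[f]_r + ε^{-s}‖f‖₀)` and (A.3) `[f]_s ≤ C‖f‖₀^{1-s/r}[f]_r^{s/r}`
(`0 ≤ s ≤ r`), which they use throughout §§3–4 ("the standard interpolation inequalities on
Hölder norms"). For the accepted norms of the tree,
`eContDiffHolderNorm k α f = Σ_{j≤k} ‖Dʲf‖_∞ + [Dᵏf]_α` (`HolderNorm.lean`), this file proves the
discrete log-convexity in the order `k` at fixed `α`,

  `‖f‖_{m+1,α}² ≤ 51 ‖f‖_{m,α} ‖f‖_{m+2,α}`   (`eContDiffHolderNorm_succ_sq_le`),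

for `C^{m+2}` maps with `‖f‖_{m,α}, ‖f‖_{m+2,α} < ∞` on a real normed space; the companion file
`TorusHolderInterpolation.lean` turns it into the product inequalities
`‖f‖_{i,α}‖f‖_{j,α} ≲ ‖f‖_{1,α}‖f‖_{i+j-1,α}` on the torus that (A.3) is used for in §3.

## Proof

Two elementary second-difference estimates for a differentiable `g` on a real normed space,
both optimised over the step `h` (`sq_le_four_mul_of_forall_le_div_add_mul`):

* **Landau's inequality** `‖Dg‖_∞² ≤ 8 ‖g‖_∞ Lip(Dg)` (`sq_norm_fderiv_le_of_bounded`): by the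
  mean value inequality with remainder (`Convex.norm_image_sub_le_of_norm_fderiv_le'`),
  `‖g(x+he) - g(x) - h Dg(x)e‖ ≤ Lip(Dg) h²‖e‖²`;
* **its Hölder analogue** `[Dg]_α² ≤ 8 [g]_α [D²g]_α` (`sq_norm_fderiv_sub_le_of_holder`): the
  same inequality for `w ↦ g(w) - g(w + (y - x))`, whose derivative increments along `[x, x+he]`
  are bounded by `[D²g]_α ‖x-y‖^α h‖e‖`, bounds the second difference
  `[g(x+he) - g(y+he)] - [g(x) - g(y)] - h(Dg(x) - Dg(y))e`.

Applied to `g = Dᵐf` (`fderiv (iteratedFDeriv m f) = curryLeft ∘ iteratedFDeriv (m+1) f`, an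
isometric identification, Mathlib `fderiv_iteratedFDeriv`), these give
`‖Dᵐ⁺¹f‖_∞² ≤ 8‖Dᵐf‖_∞‖Dᵐ⁺²f‖_∞` and `[Dᵐ⁺¹f]_α² ≤ 8[Dᵐf]_α[Dᵐ⁺²f]_α`, and with
`(a+b+c)² ≤ 3(a²+b²+c²)` the stated log-convexity (constant `3·(1+8+8) = 51`).

## References

* T. Buckmaster, C. De Lellis, L. Székelyhidi Jr., V. Vicol, *Onsager's conjecture for admissible
  weak solutions*, CPAM 72 (2019) = arXiv:1701.08678, App. A, (A.1)–(A.3). [`BuckmasterEtAl2018`]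
* D. Gilbarg, N. Trudinger, *Elliptic PDE of second order* (2001), §6.8, Lemma 6.35
  (interpolation inequalities in Hölder spaces).
-/

noncomputable section

open Set Filter Metric Function
open scoped NNReal ENNReal Topology

namespace Literature.Analysis.FunctionSpaces

/-! ## Optimising `a ≤ P/h + Q h` over `h > 0` -/

/-- If `a ≤ P/h + Q h` for every `h > 0` (`a, P, Q ≥ 0`), then `a² ≤ 4 P Q`. [folklore] -/
theorem sq_le_four_mul_of_forall_le_div_add_mul {a P Q : ℝ} (ha : 0 ≤ a) (hP : 0 ≤ P) (hQ : 0 ≤ Q)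
    (h : ∀ t : ℝ, 0 < t → a ≤ P / t + Q * t) : a ^ 2 ≤ 4 * P * Q := by
  rcases ha.eq_or_lt with rfl | ha0
  · rw [sq, zero_mul]; positivity
  rcases hP.eq_or_lt with rfl | hP0
  · -- `a ≤ Q t` for all `t > 0` forces `a ≤ 0`
    exfalso
    rcases hQ.eq_or_lt with rfl | hQ0
    · have := h 1 one_pos
      simp at this
      linarith
    · have := h (a / (2 * Q)) (by positivity)
      rw [zero_div, zero_add, mul_div_assoc', mul_comm Q a, mul_div_mul_right _ _ hQ0.ne'] at this
      linarith
  · have ht : 0 < 2 * P / a := by positivity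
    have := h (2 * P / a) ht
    have h1 : P / (2 * P / a) = a / 2 := by
      field_simp
    have h2 : Q * (2 * P / a) = 2 * P * Q / a := by ring
    rw [h1, h2] at this
    have h3 : a / 2 ≤ 2 * P * Q / a := by linarith
    rw [le_div_iff₀ ha0] at h3
    nlinarith

/-! ## Second differences of a differentiable map -/

section SecondDifference

variable {E' Z : Type*} [NormedAddCommGroup E'] [NormedSpace ℝ E'] [NormedAddCommGroup Z]
  [NormedSpace ℝ Z] {g : E' → Z}

/-- **Taylor remainder of order two along a segment.** If `g` is differentiable and `Dg` is
`M₂`-Lipschitz (`M₂ ≥ 0`), then `‖g(x + h e) - g(x) - h Dg(x) e‖ ≤ M₂ h² ‖e‖²` for `h ≥ 0` (mean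
value inequality with the linear part `Dg(x)` removed). [folklore] -/
theorem norm_sub_sub_smul_fderiv_le (hg : Differentiable ℝ g) {M₂ : ℝ} (hM₂0 : 0 ≤ M₂)
    (hM₂ : ∀ y z, ‖fderiv ℝ g y - fderiv ℝ g z‖ ≤ M₂ * ‖y - z‖) (x e : E') {h : ℝ} (hh : 0 ≤ h) :
    ‖g (x + h • e) - g x - h • fderiv ℝ g x e‖ ≤ M₂ * h ^ 2 * ‖e‖ ^ 2 := by
  -- the mean value inequality with remainder on the segment `[x, x + h • e]`
  have hseg : Convex ℝ (segment ℝ x (x + h • e)) := convex_segment _ _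
  have hbound : ∀ z ∈ segment ℝ x (x + h • e), ‖fderiv ℝ g z - fderiv ℝ g x‖ ≤ M₂ * (h * ‖e‖) := by
    intro z hz
    refine (hM₂ z x).trans (mul_le_mul_of_nonneg_left ?_ hM₂0)
    rw [segment_eq_image'] at hz
    obtain ⟨θ, hθ, rfl⟩ := hz
    rw [add_sub_cancel_left, add_sub_cancel_left, norm_smul, norm_smul, Real.norm_eq_abs,
      Real.norm_eq_abs, abs_of_nonneg hθ.1, abs_of_nonneg hh]
    calc θ * (h * ‖e‖) ≤ 1 * (h * ‖e‖) := mul_le_mul_of_nonneg_right hθ.2 (by positivity)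
      _ = h * ‖e‖ := one_mul _
  have hmvt := hseg.norm_image_sub_le_of_norm_fderiv_le' (fun z _ => (hg z))
    hbound (left_mem_segment ℝ x (x + h • e)) (right_mem_segment ℝ x (x + h • e))
  rw [add_sub_cancel_left, map_smul, norm_smul, Real.norm_eq_abs, abs_of_nonneg hh] at hmvt
  calc ‖g (x + h • e) - g x - h • fderiv ℝ g x e‖ ≤ M₂ * (h * ‖e‖) * (h * ‖e‖) := hmvt
    _ = M₂ * h ^ 2 * ‖e‖ ^ 2 := by ring

/-- From a bound `‖h • L e‖ ≤ A + B h² ‖e‖²` for all `h > 0` and all `e` to the operator-norm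
bound `‖L‖ ≤ A/h + B h` for every `h > 0` (replace `h` by `h/‖e‖`). [folklore] -/
theorem opNorm_le_div_add_mul_of_forall {L : E' →L[ℝ] Z} {A B : ℝ} (hA : 0 ≤ A) (hB : 0 ≤ B)
    (hL : ∀ (h : ℝ), 0 < h → ∀ e : E', ‖h • L e‖ ≤ A + B * h ^ 2 * ‖e‖ ^ 2) {h : ℝ} (hh : 0 < h) :
    ‖L‖ ≤ A / h + B * h := by
  refine ContinuousLinearMap.opNorm_le_bound _ (by positivity) fun e => ?_
  rcases eq_or_ne e 0 with rfl | he
  · simp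
  have hne : 0 < ‖e‖ := norm_pos_iff.2 he
  have hh' : 0 < h / ‖e‖ := div_pos hh hne
  have h1 := hL (h / ‖e‖) hh' e
  rw [norm_smul, Real.norm_eq_abs, abs_of_pos hh'] at h1
  -- `(h/‖e‖) ‖L e‖ ≤ A + B (h/‖e‖)² ‖e‖² = A + B h²`
  have h2 : B * (h / ‖e‖) ^ 2 * ‖e‖ ^ 2 = B * h ^ 2 := by
    field_simp
  rw [h2] at h1
  rw [div_mul_eq_mul_div, div_le_iff₀ hne] at h1
  -- `h ‖L e‖ ≤ (A + B h²) ‖e‖`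
  have h3 : ‖L e‖ ≤ (A + B * h ^ 2) / h * ‖e‖ := by
    rw [div_mul_eq_mul_div, le_div_iff₀ hh]
    linarith
  calc ‖L e‖ ≤ (A + B * h ^ 2) / h * ‖e‖ := h3
    _ = (A / h + B * h) * ‖e‖ := by
        congr 1
        field_simp

/-- **Landau's inequality** `‖Dg‖_∞² ≤ 8 ‖g‖_∞ Lip(Dg)`: if `‖g‖ ≤ M₀` and `Dg` is `M₂`-Lipschitz,
then `‖Dg(x)‖² ≤ 8 M₀ M₂` for every `x` (second differences optimised over the step).
[folklore] -/
theorem sq_norm_fderiv_le_of_bounded (hg : Differentiable ℝ g) {M₀ M₂ : ℝ} (hM₀0 : 0 ≤ M₀)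
    (hM₂0 : 0 ≤ M₂) (hM₀ : ∀ x, ‖g x‖ ≤ M₀)
    (hM₂ : ∀ y z, ‖fderiv ℝ g y - fderiv ℝ g z‖ ≤ M₂ * ‖y - z‖) (x : E') :
    ‖fderiv ℝ g x‖ ^ 2 ≤ 8 * M₀ * M₂ := by
  have hL : ∀ (h : ℝ), 0 < h → ∀ e : E',
      ‖h • fderiv ℝ g x e‖ ≤ 2 * M₀ + M₂ * h ^ 2 * ‖e‖ ^ 2 := by
    intro h hh e
    have h1 := norm_sub_sub_smul_fderiv_le hg hM₂0 hM₂ x e hh.le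
    calc ‖h • fderiv ℝ g x e‖
        = ‖(g (x + h • e) - g x) - (g (x + h • e) - g x - h • fderiv ℝ g x e)‖ := by
          congr 1; abel
      _ ≤ ‖g (x + h • e) - g x‖ + ‖g (x + h • e) - g x - h • fderiv ℝ g x e‖ := norm_sub_le _ _
      _ ≤ (‖g (x + h • e)‖ + ‖g x‖) + M₂ * h ^ 2 * ‖e‖ ^ 2 := add_le_add (norm_sub_le _ _) h1
      _ ≤ 2 * M₀ + M₂ * h ^ 2 * ‖e‖ ^ 2 := by linarith [hM₀ (x + h • e), hM₀ x]
  have hopt : ∀ t : ℝ, 0 < t → ‖fderiv ℝ g x‖ ≤ 2 * M₀ / t + M₂ * t := fun t ht =>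
    opNorm_le_div_add_mul_of_forall (by positivity) hM₂0 hL ht
  have h := sq_le_four_mul_of_forall_le_div_add_mul (norm_nonneg _) (by positivity) hM₂0 hopt
  linarith

/-- **Hölder second differences**: if `g` is `α`-Hölder with constant `H₀` and the derivative
increments `w ↦ Dg(w) - Dg(w + v)` are Lipschitz with constant `H₂‖v‖^α` for every shift `v`
(which is the case when `D²g` is `α`-Hölder with constant `H₂`), then
`‖Dg(x) - Dg(y)‖² ≤ 8 H₀ H₂ ‖x - y‖^{2α}`, i.e. `[Dg]_α ≤ √8 ([g]_α [D²g]_α)^{1/2}`.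
[folklore] -/
theorem sq_norm_fderiv_sub_le_of_holder (hg : Differentiable ℝ g) {α : ℝ≥0} {H₀ H₂ : ℝ}
    (hH₀0 : 0 ≤ H₀) (hH₂0 : 0 ≤ H₂) (hH₀ : ∀ y z, ‖g y - g z‖ ≤ H₀ * ‖y - z‖ ^ (α : ℝ))
    (hH₂ : ∀ v z x, ‖(fderiv ℝ g z - fderiv ℝ g (z + v)) - (fderiv ℝ g x - fderiv ℝ g (x + v))‖ ≤
      H₂ * ‖v‖ ^ (α : ℝ) * ‖z - x‖) (x y : E') :
    ‖fderiv ℝ g x - fderiv ℝ g y‖ ^ 2 ≤ 8 * H₀ * H₂ * (‖x - y‖ ^ (α : ℝ)) ^ 2 := by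
  set v : E' := y - x with hv
  set ρ : ℝ := ‖x - y‖ ^ (α : ℝ) with hρ
  have hρ0 : 0 ≤ ρ := Real.rpow_nonneg (norm_nonneg _) _
  have hvρ : ‖v‖ ^ (α : ℝ) = ρ := by rw [hv, hρ, norm_sub_rev]
  -- the difference map `Δ w = g w - g (w + v)`, with `Δ x = g x - g y`
  set Δ : E' → Z := fun w => g w - g (w + v) with hΔ
  have hΔd : Differentiable ℝ Δ := hg.sub (hg.comp (differentiable_id.add_const v))
  have hDΔ : ∀ w, fderiv ℝ Δ w = fderiv ℝ g w - fderiv ℝ g (w + v) := by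
    intro w
    have h1 : DifferentiableAt ℝ (fun w => g (w + v)) w :=
      (differentiableAt_comp_add_right v).2 (hg (w + v))
    rw [hΔ, fderiv_fun_sub (hg w) h1, fderiv_comp_add_right]
  have hxv : x + v = y := by rw [hv]; abel
  have hL : ∀ (h : ℝ), 0 < h → ∀ e : E',
      ‖h • (fderiv ℝ g x - fderiv ℝ g y) e‖ ≤ 2 * (H₀ * ρ) + (H₂ * ρ) * h ^ 2 * ‖e‖ ^ 2 := by
    intro h hh e
    -- Lipschitz bound for `DΔ` along the segment
    have hlip : ∀ w z, ‖fderiv ℝ Δ w - fderiv ℝ Δ z‖ ≤ H₂ * ρ * ‖w - z‖ := by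
      intro w z
      rw [hDΔ, hDΔ, ← hvρ]
      exact hH₂ v w z
    have h1 := norm_sub_sub_smul_fderiv_le hΔd (by positivity) hlip x e hh.le
    have hΔx : Δ x = g x - g y := by simp only [hΔ, hxv]
    have hΔxe : Δ (x + h • e) = g (x + h • e) - g (y + h • e) := by
      simp only [hΔ]
      congr 2
      rw [← hxv]; abel
    have hDx : fderiv ℝ Δ x = fderiv ℝ g x - fderiv ℝ g y := by rw [hDΔ, hxv]
    rw [hΔx, hΔxe, hDx] at h1
    have hb1 : ‖g (x + h • e) - g (y + h • e)‖ ≤ H₀ * ρ := by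
      have := hH₀ (x + h • e) (y + h • e)
      rwa [show x + h • e - (y + h • e) = x - y by abel, ← hρ] at this
    have hb2 : ‖g x - g y‖ ≤ H₀ * ρ := by rw [hρ]; exact hH₀ x y
    calc ‖h • (fderiv ℝ g x - fderiv ℝ g y) e‖
        = ‖(g (x + h • e) - g (y + h • e)) - (g x - g y) -
            ((g (x + h • e) - g (y + h • e)) - (g x - g y) - h • (fderiv ℝ g x - fderiv ℝ g y) e)‖ := by
          congr 1; abel
      _ ≤ ‖(g (x + h • e) - g (y + h • e)) - (g x - g y)‖ +
            ‖(g (x + h • e) - g (y + h • e)) - (g x - g y) - h • (fderiv ℝ g x - fderiv ℝ g y) e‖ :=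
          norm_sub_le _ _
      _ ≤ (‖g (x + h • e) - g (y + h • e)‖ + ‖g x - g y‖) + H₂ * ρ * h ^ 2 * ‖e‖ ^ 2 :=
          add_le_add (norm_sub_le _ _) h1
      _ ≤ 2 * (H₀ * ρ) + H₂ * ρ * h ^ 2 * ‖e‖ ^ 2 := by linarith
  have hopt : ∀ t : ℝ, 0 < t → ‖fderiv ℝ g x - fderiv ℝ g y‖ ≤ 2 * (H₀ * ρ) / t + H₂ * ρ * t :=
    fun t ht => by
      have := opNorm_le_div_add_mul_of_forall (L := fderiv ℝ g x - fderiv ℝ g y) (by positivity)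
        (by positivity) hL ht
      exact this
  have h := sq_le_four_mul_of_forall_le_div_add_mul (norm_nonneg _) (by positivity) (by positivity) hopt
  calc ‖fderiv ℝ g x - fderiv ℝ g y‖ ^ 2 ≤ 4 * (2 * (H₀ * ρ)) * (H₂ * ρ) := h
    _ = 8 * H₀ * H₂ * ρ ^ 2 := by ring

/-- The Lipschitz bound on derivative increments used in `sq_norm_fderiv_sub_le_of_holder`, from
a Hölder second derivative: if `φ` is differentiable and `‖Dφ(a) - Dφ(b)‖ ≤ H₂ ‖a - b‖^α`, then
`‖(φ z - φ (z + v)) - (φ x - φ (x + v))‖ ≤ H₂ ‖v‖^α ‖z - x‖` (mean value inequality for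
`w ↦ φ w - φ (w + v)`). [folklore] -/
theorem norm_sub_sub_sub_le_of_fderiv_holder {φ : E' → Z} (hφ : Differentiable ℝ φ) {α : ℝ≥0}
    {H₂ : ℝ} (hH₂ : ∀ a b, ‖fderiv ℝ φ a - fderiv ℝ φ b‖ ≤ H₂ * ‖a - b‖ ^ (α : ℝ)) (v z x : E') :
    ‖(φ z - φ (z + v)) - (φ x - φ (x + v))‖ ≤ H₂ * ‖v‖ ^ (α : ℝ) * ‖z - x‖ := by
  set Ψ : E' → Z := fun w => φ w - φ (w + v) with hΨ
  have hΨd : ∀ w, DifferentiableAt ℝ Ψ w := fun w =>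
    (hφ w).sub ((differentiableAt_comp_add_right v).2 (hφ (w + v)))
  have hDΨ : ∀ w, fderiv ℝ Ψ w = fderiv ℝ φ w - fderiv ℝ φ (w + v) := by
    intro w
    have h1 : DifferentiableAt ℝ (fun w => φ (w + v)) w :=
      (differentiableAt_comp_add_right v).2 (hφ (w + v))
    rw [hΨ, fderiv_fun_sub (hφ w) h1, fderiv_comp_add_right]
  have hb : ∀ w ∈ (univ : Set E'), ‖fderiv ℝ Ψ w‖ ≤ H₂ * ‖v‖ ^ (α : ℝ) := by
    intro w _
    rw [hDΨ]
    have := hH₂ w (w + v)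
    rwa [show w - (w + v) = -v by abel, norm_neg] at this
  have h := Convex.norm_image_sub_le_of_norm_fderiv_le (fun w _ => hΨd w) hb convex_univ
    (mem_univ x) (mem_univ z)
  simpa only [hΨ] using h

end SecondDifference

/-! ## The levels `Dᵐf`, `Dᵐ⁺¹f`, `Dᵐ⁺²f` -/

section Levels

variable {E' Y : Type*} [NormedAddCommGroup E'] [NormedSpace ℝ E'] [NormedAddCommGroup Y]
  [NormedSpace ℝ Y] {f : E' → Y} {m : ℕ}

/-- `fderiv (Dᵐf)` is `Dᵐ⁺¹f` read through the (isometric) left-currying equivalence, so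
increments have the same norm: `‖D(Dᵐf)(a) - D(Dᵐf)(b)‖ = ‖Dᵐ⁺¹f(a) - Dᵐ⁺¹f(b)‖`
(Mathlib `fderiv_iteratedFDeriv`). [folklore] -/
theorem norm_fderiv_iteratedFDeriv_sub (f : E' → Y) (m : ℕ) (a b : E') :
    ‖fderiv ℝ (iteratedFDeriv ℝ m f) a - fderiv ℝ (iteratedFDeriv ℝ m f) b‖ =
      ‖iteratedFDeriv ℝ (m + 1) f a - iteratedFDeriv ℝ (m + 1) f b‖ := by
  rw [fderiv_iteratedFDeriv]
  simp only [comp_apply]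
  rw [← LinearIsometryEquiv.map_sub, LinearIsometryEquiv.norm_map]

/-- Second differences of `fderiv (Dᵐf)` are those of `Dᵐ⁺¹f`. [folklore] -/
theorem norm_fderiv_iteratedFDeriv_sub_sub (f : E' → Y) (m : ℕ) (a b c e : E') :
    ‖(fderiv ℝ (iteratedFDeriv ℝ m f) a - fderiv ℝ (iteratedFDeriv ℝ m f) b) -
        (fderiv ℝ (iteratedFDeriv ℝ m f) c - fderiv ℝ (iteratedFDeriv ℝ m f) e)‖ =
      ‖(iteratedFDeriv ℝ (m + 1) f a - iteratedFDeriv ℝ (m + 1) f b) -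
        (iteratedFDeriv ℝ (m + 1) f c - iteratedFDeriv ℝ (m + 1) f e)‖ := by
  rw [fderiv_iteratedFDeriv]
  simp only [comp_apply]
  rw [← LinearIsometryEquiv.map_sub, ← LinearIsometryEquiv.map_sub, ← LinearIsometryEquiv.map_sub,
    LinearIsometryEquiv.norm_map]

omit [NormedSpace ℝ Y] in
/-- Real sup bounds from a finite extended sup norm. [folklore] -/
theorem norm_le_toReal_eSupNorm {X : Type*} {g : X → Y} (hg : eSupNorm g ≠ ⊤) (x : X) :
    ‖g x‖ ≤ (eSupNorm g).toReal := by
  rw [← ENNReal.ofReal_le_iff_le_toReal hg, ofReal_norm]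
  exact enorm_le_eSupNorm g x

omit [NormedSpace ℝ Y] in
/-- Real Hölder bounds from a finite extended Hölder seminorm (real normed spaces). [folklore] -/
theorem norm_sub_le_toReal_eHolderNorm {X : Type*} [NormedAddCommGroup X] {g : X → Y} {r : ℝ≥0}
    (hg : eHolderNorm r g ≠ ⊤) (x y : X) :
    ‖g x - g y‖ ≤ (eHolderNorm r g).toReal * ‖x - y‖ ^ (r : ℝ) := by
  have hmem : MemHolder r g := eHolderNorm_ne_top.1 hg
  have h := hmem.holderWith.dist_le x y
  rw [dist_eq_norm, dist_eq_norm] at h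
  rwa [← hmem.coe_nnHolderNorm_eq_eHolderNorm, ENNReal.coe_toReal]

/-- **Landau's inequality for the derivative levels**: for a `C^{m+2}` map with `‖Dᵐf‖_∞` and
`‖Dᵐ⁺²f‖_∞` finite, `‖Dᵐ⁺¹f‖_∞² ≤ 8 ‖Dᵐf‖_∞ ‖Dᵐ⁺²f‖_∞`. [folklore] -/
theorem eSupNorm_iteratedFDeriv_succ_sq_le (hf : ContDiff ℝ (m + 2 : ℕ) f)
    (h0 : eSupNorm (iteratedFDeriv ℝ m f) ≠ ⊤) (h2 : eSupNorm (iteratedFDeriv ℝ (m + 2) f) ≠ ⊤) :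
    eSupNorm (iteratedFDeriv ℝ (m + 1) f) ^ 2 ≤
      8 * eSupNorm (iteratedFDeriv ℝ m f) * eSupNorm (iteratedFDeriv ℝ (m + 2) f) := by
  set g := iteratedFDeriv ℝ m f with hg_def
  set M₀ := (eSupNorm (iteratedFDeriv ℝ m f)).toReal with hM₀
  set M₂ := (eSupNorm (iteratedFDeriv ℝ (m + 2) f)).toReal with hM₂
  have hM₀0 : 0 ≤ M₀ := ENNReal.toReal_nonneg
  have hM₂0 : 0 ≤ M₂ := ENNReal.toReal_nonneg
  have hgd : Differentiable ℝ g := hf.differentiable_iteratedFDeriv (by exact_mod_cast (by omega : m < m + 2))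
  have hg1d : Differentiable ℝ (iteratedFDeriv ℝ (m + 1) f) :=
    hf.differentiable_iteratedFDeriv (by exact_mod_cast (by omega : m + 1 < m + 2))
  have hbd0 : ∀ x, ‖g x‖ ≤ M₀ := norm_le_toReal_eSupNorm h0
  -- `D(Dᵐf)` is `M₂`-Lipschitz: increments are those of `Dᵐ⁺¹f`, whose derivative is `Dᵐ⁺²f`
  have hlip : ∀ y z, ‖fderiv ℝ g y - fderiv ℝ g z‖ ≤ M₂ * ‖y - z‖ := by
    intro y z
    rw [norm_fderiv_iteratedFDeriv_sub]
    refine Convex.norm_image_sub_le_of_norm_fderiv_le (fun w _ => hg1d w) (fun w _ => ?_)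
      convex_univ (mem_univ z) (mem_univ y)
    rw [norm_fderiv_iteratedFDeriv]
    exact norm_le_toReal_eSupNorm h2 w
  have hpt : ∀ x, ‖iteratedFDeriv ℝ (m + 1) f x‖ ≤ Real.sqrt (8 * M₀ * M₂) := by
    intro x
    rw [← norm_fderiv_iteratedFDeriv]
    refine Real.le_sqrt_of_sq_le ?_
    exact sq_norm_fderiv_le_of_bounded hgd hM₀0 hM₂0 hbd0 hlip x
  have hsup : eSupNorm (iteratedFDeriv ℝ (m + 1) f) ≤ ENNReal.ofReal (Real.sqrt (8 * M₀ * M₂)) :=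
    eSupNorm_le_ofReal hpt
  calc eSupNorm (iteratedFDeriv ℝ (m + 1) f) ^ 2 ≤ ENNReal.ofReal (Real.sqrt (8 * M₀ * M₂)) ^ 2 := by
        gcongr
    _ = ENNReal.ofReal (8 * M₀ * M₂) := by
        rw [← ENNReal.ofReal_pow (Real.sqrt_nonneg _), Real.sq_sqrt (by positivity)]
    _ = 8 * eSupNorm (iteratedFDeriv ℝ m f) * eSupNorm (iteratedFDeriv ℝ (m + 2) f) := by
        rw [ENNReal.ofReal_mul (by positivity), ENNReal.ofReal_mul (by norm_num), ENNReal.ofReal_ofNat,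
          hM₀, hM₂, ENNReal.ofReal_toReal h0, ENNReal.ofReal_toReal h2]

/-- **Hölder log-convexity of the derivative levels**: for a `C^{m+2}` map with `[Dᵐf]_α` and
`[Dᵐ⁺²f]_α` finite, `[Dᵐ⁺¹f]_α² ≤ 8 [Dᵐf]_α [Dᵐ⁺²f]_α`. [folklore] -/
theorem eHolderNorm_iteratedFDeriv_succ_sq_le (hf : ContDiff ℝ (m + 2 : ℕ) f) {α : ℝ≥0}
    (h0 : eHolderNorm α (iteratedFDeriv ℝ m f) ≠ ⊤) (h2 : eHolderNorm α (iteratedFDeriv ℝ (m + 2) f) ≠ ⊤) :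
    eHolderNorm α (iteratedFDeriv ℝ (m + 1) f) ^ 2 ≤
      8 * eHolderNorm α (iteratedFDeriv ℝ m f) * eHolderNorm α (iteratedFDeriv ℝ (m + 2) f) := by
  set g := iteratedFDeriv ℝ m f with hg_def
  set H₀ := (eHolderNorm α (iteratedFDeriv ℝ m f)).toReal with hH₀
  set H₂ := (eHolderNorm α (iteratedFDeriv ℝ (m + 2) f)).toReal with hH₂
  have hH₀0 : 0 ≤ H₀ := ENNReal.toReal_nonneg
  have hH₂0 : 0 ≤ H₂ := ENNReal.toReal_nonneg
  have hgd : Differentiable ℝ g := hf.differentiable_iteratedFDeriv (by exact_mod_cast (by omega : m < m + 2))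
  have hg1d : Differentiable ℝ (iteratedFDeriv ℝ (m + 1) f) :=
    hf.differentiable_iteratedFDeriv (by exact_mod_cast (by omega : m + 1 < m + 2))
  have hH₀b : ∀ y z, ‖g y - g z‖ ≤ H₀ * ‖y - z‖ ^ (α : ℝ) := norm_sub_le_toReal_eHolderNorm h0
  -- Hölder bound for the derivative of `Dᵐ⁺¹f`, read as `Dᵐ⁺²f`
  have hD2 : ∀ a b, ‖fderiv ℝ (iteratedFDeriv ℝ (m + 1) f) a - fderiv ℝ (iteratedFDeriv ℝ (m + 1) f) b‖ ≤
      H₂ * ‖a - b‖ ^ (α : ℝ) := by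
    intro a b
    rw [norm_fderiv_iteratedFDeriv_sub]
    exact norm_sub_le_toReal_eHolderNorm h2 a b
  have hH₂b : ∀ v z x, ‖(fderiv ℝ g z - fderiv ℝ g (z + v)) - (fderiv ℝ g x - fderiv ℝ g (x + v))‖ ≤
      H₂ * ‖v‖ ^ (α : ℝ) * ‖z - x‖ := by
    intro v z x
    rw [norm_fderiv_iteratedFDeriv_sub_sub]
    exact norm_sub_sub_sub_le_of_fderiv_holder hg1d hD2 v z x
  have hpt : ∀ x y, ‖iteratedFDeriv ℝ (m + 1) f x - iteratedFDeriv ℝ (m + 1) f y‖ ≤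
      Real.sqrt (8 * H₀ * H₂) * ‖x - y‖ ^ (α : ℝ) := by
    intro x y
    rw [← norm_fderiv_iteratedFDeriv_sub]
    have h := sq_norm_fderiv_sub_le_of_holder hgd hH₀0 hH₂0 hH₀b hH₂b x y
    have hρ : 0 ≤ ‖x - y‖ ^ (α : ℝ) := Real.rpow_nonneg (norm_nonneg _) _
    calc ‖fderiv ℝ g x - fderiv ℝ g y‖ = Real.sqrt (‖fderiv ℝ g x - fderiv ℝ g y‖ ^ 2) :=
          (Real.sqrt_sq (norm_nonneg (fderiv ℝ g x - fderiv ℝ g y))).symm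
      _ ≤ Real.sqrt (8 * H₀ * H₂ * (‖x - y‖ ^ (α : ℝ)) ^ 2) := Real.sqrt_le_sqrt h
      _ = Real.sqrt (8 * H₀ * H₂) * ‖x - y‖ ^ (α : ℝ) := by
          rw [Real.sqrt_mul (by positivity), Real.sqrt_sq hρ]
  -- hence a `HolderWith` bound and the seminorm estimate
  set C : ℝ≥0 := ⟨Real.sqrt (8 * H₀ * H₂), Real.sqrt_nonneg _⟩ with hC
  have hCr : (C : ℝ) = Real.sqrt (8 * H₀ * H₂) := rfl
  have hHW : HolderWith C α (iteratedFDeriv ℝ (m + 1) f) := by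
    refine holderWith_of_dist_le fun x y => ?_
    rw [dist_eq_norm, dist_eq_norm, hCr]
    exact hpt x y
  calc eHolderNorm α (iteratedFDeriv ℝ (m + 1) f) ^ 2 ≤ (C : ℝ≥0∞) ^ 2 := by
        gcongr
        exact hHW.eHolderNorm_le
    _ = ENNReal.ofReal (8 * H₀ * H₂) := by
        rw [ENNReal.coe_nnreal_eq, hCr, ← ENNReal.ofReal_pow (Real.sqrt_nonneg _),
          Real.sq_sqrt (by positivity)]
    _ = 8 * eHolderNorm α (iteratedFDeriv ℝ m f) * eHolderNorm α (iteratedFDeriv ℝ (m + 2) f) := by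
        rw [ENNReal.ofReal_mul (by positivity), ENNReal.ofReal_mul (by norm_num), ENNReal.ofReal_ofNat,
          hH₀, hH₂, ENNReal.ofReal_toReal h0, ENNReal.ofReal_toReal h2]

end Levels

/-! ## Log-convexity of the `C^{k,α}` norms -/

section LogConvex

variable {E' Y : Type*} [NormedAddCommGroup E'] [NormedSpace ℝ E'] [NormedAddCommGroup Y]
  [NormedSpace ℝ Y] {f : E' → Y} {m : ℕ} {α : ℝ≥0}

/-- `(a + b + c)² ≤ 3 (a² + b² + c²)` in `ℝ≥0∞`. [folklore] -/
theorem ENNReal.add_three_sq_le (a b c : ℝ≥0∞) : (a + b + c) ^ 2 ≤ 3 * (a ^ 2 + b ^ 2 + c ^ 2) := by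
  rcases eq_or_ne a ⊤ with rfl | ha
  · simp
  rcases eq_or_ne b ⊤ with rfl | hb
  · simp
  rcases eq_or_ne c ⊤ with rfl | hc
  · simp
  lift a to ℝ≥0 using ha
  lift b to ℝ≥0 using hb
  lift c to ℝ≥0 using hc
  have h : ((a + b + c) ^ 2 : ℝ≥0) ≤ 3 * (a ^ 2 + b ^ 2 + c ^ 2) := by
    rw [← NNReal.coe_le_coe]
    push_cast
    nlinarith [sq_nonneg ((a : ℝ) - b), sq_nonneg ((b : ℝ) - c), sq_nonneg ((a : ℝ) - c)]
  exact_mod_cast h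

/-- **Log-convexity of the `C^{k,α}` norms in the order.** For a `C^{m+2}` map `f` on a real
normed space with `‖f‖_{m,α} < ∞` and `‖f‖_{m+2,α} < ∞`,
`‖f‖_{m+1,α}² ≤ 51 ‖f‖_{m,α} ‖f‖_{m+2,α}` (`eContDiffHolderNorm`; the discrete form of the Hölder
interpolation inequalities BDSV (A.1)/(A.3), Gilbarg–Trudinger Lemma 6.35). Proof:
`‖f‖_{m+1,α} = Σ_{j≤m}‖Dʲf‖_∞ + ‖Dᵐ⁺¹f‖_∞ + [Dᵐ⁺¹f]_α`, the first sum is at most both norms, and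
the last two terms are controlled by Landau's inequality and its Hölder analogue.
[cite: BuckmasterEtAl2018, App. A (A.1)-(A.3)] -/
theorem eContDiffHolderNorm_succ_sq_le (hf : ContDiff ℝ (m + 2 : ℕ) f)
    (h0 : eContDiffHolderNorm m α f ≠ ⊤) (h2 : eContDiffHolderNorm (m + 2) α f ≠ ⊤) :
    eContDiffHolderNorm (m + 1) α f ^ 2 ≤
      51 * eContDiffHolderNorm m α f * eContDiffHolderNorm (m + 2) α f := by
  -- notation
  set S : ℕ → ℝ≥0∞ := fun k => ∑ j ∈ Finset.range (k + 1), eSupNorm (iteratedFDeriv ℝ j f) with hS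
  set s : ℕ → ℝ≥0∞ := fun j => eSupNorm (iteratedFDeriv ℝ j f) with hs
  set H : ℕ → ℝ≥0∞ := fun k => eHolderNorm α (iteratedFDeriv ℝ k f) with hH
  have hN : ∀ k, eContDiffHolderNorm k α f = S k + H k := fun k => rfl
  set P := eContDiffHolderNorm m α f * eContDiffHolderNorm (m + 2) α f with hP
  -- finiteness of the pieces
  have hSm : S m ≠ ⊤ := ne_top_of_le_ne_top h0 (by rw [hN]; exact le_self_add)
  have hSm2 : S (m + 2) ≠ ⊤ := ne_top_of_le_ne_top h2 (by rw [hN]; exact le_self_add)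
  have hHm : H m ≠ ⊤ := ne_top_of_le_ne_top h0 (by rw [hN]; exact le_add_self)
  have hHm2 : H (m + 2) ≠ ⊤ := ne_top_of_le_ne_top h2 (by rw [hN]; exact le_add_self)
  have hs_le_S : ∀ {j k : ℕ}, j ≤ k → s j ≤ S k := fun {j k} hjk =>
    Finset.single_le_sum (f := fun i => eSupNorm (iteratedFDeriv ℝ i f)) (fun _ _ => bot_le)
      (Finset.mem_range.2 (Nat.lt_succ_of_le hjk))
  have hsm : s m ≠ ⊤ := ne_top_of_le_ne_top hSm (hs_le_S le_rfl)
  have hsm2 : s (m + 2) ≠ ⊤ := ne_top_of_le_ne_top hSm2 (hs_le_S le_rfl)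
  -- the three squares
  have hS_mono : S m ≤ S (m + 2) := by
    simp only [hS]
    exact Finset.sum_le_sum_of_subset fun x hx =>
      Finset.mem_range.2 (lt_of_lt_of_le (Finset.mem_range.1 hx) (by omega))
  have h1 : S m ^ 2 ≤ P := by
    rw [sq, hP]
    exact mul_le_mul' (by rw [hN]; exact le_self_add) (hS_mono.trans (by rw [hN]; exact le_self_add))
  have h2' : s (m + 1) ^ 2 ≤ 8 * P := by
    calc s (m + 1) ^ 2 ≤ 8 * s m * s (m + 2) := eSupNorm_iteratedFDeriv_succ_sq_le hf hsm hsm2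
      _ ≤ 8 * eContDiffHolderNorm m α f * eContDiffHolderNorm (m + 2) α f := by
          refine mul_le_mul' (mul_le_mul' le_rfl ?_) ?_
          · exact (hs_le_S le_rfl).trans (by rw [hN]; exact le_self_add)
          · exact (hs_le_S le_rfl).trans (by rw [hN]; exact le_self_add)
      _ = 8 * P := by rw [hP, mul_assoc]
  have h3 : H (m + 1) ^ 2 ≤ 8 * P := by
    calc H (m + 1) ^ 2 ≤ 8 * H m * H (m + 2) := eHolderNorm_iteratedFDeriv_succ_sq_le hf hHm hHm2
      _ ≤ 8 * eContDiffHolderNorm m α f * eContDiffHolderNorm (m + 2) α f := by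
          refine mul_le_mul' (mul_le_mul' le_rfl ?_) ?_
          · rw [hN]; exact le_add_self
          · rw [hN]; exact le_add_self
      _ = 8 * P := by rw [hP, mul_assoc]
  -- `‖f‖_{m+1,α} = S m + s (m+1) + H (m+1)`
  have hsplit : eContDiffHolderNorm (m + 1) α f = S m + s (m + 1) + H (m + 1) := by
    rw [hN]
    simp only [hS, hs]
    rw [Finset.sum_range_succ]
  rw [hsplit]
  calc (S m + s (m + 1) + H (m + 1)) ^ 2 ≤ 3 * (S m ^ 2 + s (m + 1) ^ 2 + H (m + 1) ^ 2) :=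
        ENNReal.add_three_sq_le _ _ _
    _ ≤ 3 * (P + 8 * P + 8 * P) := by gcongr
    _ = 51 * P := by ring
    _ = 51 * eContDiffHolderNorm m α f * eContDiffHolderNorm (m + 2) α f := by rw [hP, mul_assoc]

end LogConvex

end Literature.Analysis.FunctionSpaces
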